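import Summits.ResolutionOfSingularities.ResolutionOfSingularities.Theorems.EquisingularLiftEquisingularLiftNatTowerBPairRoundCoreFour
import Summits.ResolutionOfSingularities.ResolutionOfSingularities.Theorems.EquisingularLiftEquisingularLiftNatTowerBPairRoundOfFact
import HarnessLib

/-!
# [OURS · L1 W4.5(b) · EL♮(3) · T23-A‴] RoF‴ (PAIR / FIBRE PAIR) — THE BOUNDARY-WITNESSED ROUND ON `Tower.InvB₄` AT THE DATUM «`V(𝓔)` IS `O`-FLAT»
# (NO `TowerFull`) = res-L1-w45b-stub-4's `Tower.invB_pairRound_of_fact` (p616482) over the core‴ `Tower.invB₄_pairRoundCore` (p625601)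

res-L1-w45b-stub-2 g13 (engine owner res-L1-w45b-stub-4's word 2026-08-28T10:39:36Z «take … the three RoF‴s … `Tower.hPair_of_coneWitness` p616482 reused
verbatim — it never saw `hfull`»; (U1) `…NatTowerInvBFourDefs` p624526; transports p625145). Crux EL♮(3) = stmt-ResolutionOfSingularities-20148 (parent EL♮
stmt-…-20038; node stmt-…-15660), route `EquisingularLift`, line `sections`. OURS; NOT a statement of any manuscript; AI-written, weaker than expert review.
DEF-FREE; no `sorry`; standard axioms. `--supports stmt-ResolutionOfSingularities-20148 --as helper`.

WHAT. `Tower.invB₄_pairRound_of_fact` = p616482's `Tower.invB_pairRound_of_fact` VERBATIM (adapted copy) except: the invariant is `Tower.InvB₄ … G γ T E Es Ns K`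
(every retained member MODEL-CARRYING, model-less list `Ns`); the `TowerFull` hypothesis is GONE — this ONE theorem is branch 3 (PAIR, `TowerFull` kept
downstairs and simply not passed) AND branch 4 (FIBRE PAIR: centre over a point of the carrier, `hZdim` only) of the ‴ round step; the extra menu
`∀ F' ∈ Ns', ∃ F, (F ∈ Ns ∨ F ∈ E :: Es) ∧ F' = closure υ₂⁻¹(F ∖ Z)` (topology only); the `Es'` menu stays `RoundTransportOKDoublePrime` unfolded
(host / co-host / away / transversal); `hPair` := `Tower.hPair_of_coneWitness` (imported, with its two named inputs `hA1`/`hA2` = my (A″-1)/(A″-2) v2 shapes).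
[cite: GortzWedhorn2020, (13.19) and Prop. 13.91] [cite: Matsumura1987, Thm. 15.1 and §14] (method; index only).
-/

set_option linter.dupNamespace false -- mandated namespace `Summit.<Summit>.<Problem>` of this single-conjunct summit
set_option linter.overlappingInstances false -- signatures carry `[IsDomain O] [IsDiscreteValuationRing O]`

noncomputable section

open CategoryTheory CategoryTheory.Limits AlgebraicGeometry TopologicalSpace Topology IsLocalRing
open Literature.AlgebraicGeometry.Resolution
open AlgebraicGeometry.Scheme.IdealSheafData
open Summit.ResolutionOfSingularities.ResolutionOfSingularities.Theses.EquisingularLift.Split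
open Summit.ResolutionOfSingularities.ResolutionOfSingularities.Cruxes.EquisingularLift.StrataSplit

namespace Summit.ResolutionOfSingularities.ResolutionOfSingularities.Cruxes.EquisingularLiftNat.Sections

section Fact

variable (O : Type) [CommRing O] [IsDomain O] [IsDiscreteValuationRing O] (k : Type) [Field k]
    (θ : O →+* k) (hθ : Function.Surjective θ)
    (P : Scheme.{0}) [IsIntegral P] (q : P ⟶ Spec (.of O)) [IsProper q] [SmoothOfRelativeDimension 3 q] (Y : Set P)
    (hYsp : Y ⊆ q ⁻¹' {IsLocalRing.closedPoint O}) (hYirr : IsIrreducible Y) (hYcl : IsClosed Y)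
    (hPnoeth : IsLocallyNoetherian P) (hPreg : Scheme.IsRegular P)
    (Ch : ∀ X' : Scheme.{0}, (X' ⟶ P) → Set X' → Prop)
    (hChStep : ∀ (X' X'' : Scheme.{0}) (σ' : X' ⟶ P) (S' : Set X') (C : X'.IdealSheafData) (τ : X'' ⟶ X'),
      Ch X' σ' S' → IsBlowup τ C → Scheme.IsRegular C.subscheme → Flat (C.subschemeι ≫ σ' ≫ q) →
      σ' '' (C.support : Set X') ⊆ {y | ¬ IsGenericPoint y Y} → (C.support : Set X') ∩ (σ' ≫ q) ⁻¹' {IsLocalRing.closedPoint O} ⊆ S' →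
      Ch X'' (τ ≫ σ') (closure (τ ⁻¹' (S' \ (C.support : Set X')))))
    (hChSplit : ∀ (X' : Scheme.{0}) (σ' : X' ⟶ P) (S' : Set X'), Ch X' σ' S' → Chain P Y X' σ' S')

include hθ hYsp hYirr hYcl hPnoeth hPreg hChStep hChSplit

/-! The shapes of res-L1-w45b-stub-2's (A″-1)/(A″-2) v2 bricks `isRegular_subscheme_sup_of_trace_crossing` / `flat_subschemeι_sup_of_trace_crossing`
(engine word l.79433 (a)(b)): two stalkwise-principal models with reduced traces `E`, `F` crossing REDUCEDLY (`𝓘⟨E⟩ ⊔ 𝓘⟨F⟩ = 𝓘⟨E ∩ F⟩`) along a regular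
`(E ∩ F)~` of CODIMENSION 2 in the special fibre at its closed points have a regular, `O`-flat intersection `V(𝓔 ⊔ 𝓕)`. They enter this file as the two
section hypotheses `hA1` / `hA2` (no import of the brick's file; V10″ supplies the two theorems by name). -/
variable
    (hA1 : ∀ {G X : Scheme.{0}} [IsLocallyNoetherian X] {σ : X ⟶ P} {jG : G ⟶ X} {tG : G ⟶ Spec (.of k)} {𝓔 𝓕 : X.IdealSheafData}
      {E F : Set G} {hE : IsClosed E} {hF : IsClosed F},
      Scheme.IsRegular X → IsPullback jG tG (σ ≫ q) (Spec.map (CommRingCat.ofHom θ)) → Function.Surjective θ → IsProper (σ ≫ q) →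
      𝓔.comap jG = vanishingIdeal ⟨E, hE⟩ → (∀ x : X, (stalkIdeal 𝓔 x).IsPrincipal) →
      𝓕.comap jG = vanishingIdeal ⟨F, hF⟩ → (∀ x : X, (stalkIdeal 𝓕 x).IsPrincipal) →
      vanishingIdeal ⟨E, hE⟩ ⊔ vanishingIdeal ⟨F, hF⟩ = vanishingIdeal (⟨E ∩ F, hE.inter hF⟩ : Closeds G) →
      (∀ z : ↥(vanishingIdeal (⟨E ∩ F, hE.inter hF⟩ : Closeds G)).subscheme,
        IsRegularLocalRing ((vanishingIdeal (⟨E ∩ F, hE.inter hF⟩ : Closeds G)).subscheme.presheaf.stalk z)) →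
      (∀ g ∈ E ∩ F, IsClosed ({g} : Set G) →
        ringKrullDim (G.presheaf.stalk g ⧸ stalkIdeal (vanishingIdeal (⟨E ∩ F, hE.inter hF⟩ : Closeds G)) g) + 3 =
          ringKrullDim (X.presheaf.stalk (jG g))) →
      Scheme.IsRegular (𝓔 ⊔ 𝓕).subscheme)
    (hA2 : ∀ {G X : Scheme.{0}} [IsLocallyNoetherian X] {σ : X ⟶ P} {jG : G ⟶ X} {tG : G ⟶ Spec (.of k)} {𝓔 𝓕 : X.IdealSheafData}
      {E F : Set G} {hE : IsClosed E} {hF : IsClosed F},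
      Scheme.IsRegular X → IsPullback jG tG (σ ≫ q) (Spec.map (CommRingCat.ofHom θ)) → Function.Surjective θ → IsProper (σ ≫ q) →
      𝓔.comap jG = vanishingIdeal ⟨E, hE⟩ → (∀ x : X, (stalkIdeal 𝓔 x).IsPrincipal) →
      𝓕.comap jG = vanishingIdeal ⟨F, hF⟩ → (∀ x : X, (stalkIdeal 𝓕 x).IsPrincipal) →
      vanishingIdeal ⟨E, hE⟩ ⊔ vanishingIdeal ⟨F, hF⟩ = vanishingIdeal (⟨E ∩ F, hE.inter hF⟩ : Closeds G) →
      (∀ z : ↥(vanishingIdeal (⟨E ∩ F, hE.inter hF⟩ : Closeds G)).subscheme,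
        IsRegularLocalRing ((vanishingIdeal (⟨E ∩ F, hE.inter hF⟩ : Closeds G)).subscheme.presheaf.stalk z)) →
      (∀ g ∈ E ∩ F, IsClosed ({g} : Set G) →
        ringKrullDim (G.presheaf.stalk g ⧸ stalkIdeal (vanishingIdeal (⟨E ∩ F, hE.inter hF⟩ : Closeds G)) g) + 3 =
          ringKrullDim (X.presheaf.stalk (jG g))) →
      Flat ((𝓔 ⊔ 𝓕).subschemeι ≫ σ ≫ q))

include hA1 hA2

omit hYsp in
set_option maxHeartbeats 800000 in
/-- **RoF‴ (PAIR / FIBRE PAIR): the boundary-witnessed round on `Tower.InvB₄` at the datum «`V(𝓔)` is `O`-flat» (NO `TowerFull`; model-less list `Ns`), BOTH host menus**: host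
`H ∈ {E} ∪ Es` (shadow `KH ∈ {K, ∅}` accordingly), witness `W ∈ E :: Es` with `ConeWitness G H hH W Z hZ`, `Z̃` regular, a curve at its closed points; the list transported by
`F = H ∨ F = W ∨ Disjoint Z F ∨ (T1) ∧ (T2)` (= lead-2's `RoundTransportOKDoublePrime` unfolded). Every stand-in of the core″ discharged at `FE` except the
two (A″-1)/(A″-2) v2 bricks, which are the named inputs `hA1`/`hA2`; core = `Tower.invB₄_pairRoundCore`. [OURS · L1 W4.5b · T23-A‴ engine];
NOT a statement of the manuscript. -/
theorem Tower.invB₄_pairRound_of_fact :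
    ∀ {F₉ : Scheme.{0}} (Z₉ : Set F₉) (hZ₉ : IsClosed Z₉) {F₁₀ : Scheme.{0}} (υ' : F₁₀ ⟶ F₉)
    (G G' : Scheme.{0}) (γ : G ⟶ F₁₀) (T E : Set G) (Es Ns : List (Set G)) (K H KH : Set G) (hH : IsClosed H) (Z : Set G) (hZ : IsClosed Z)
    (W : Set G) (hW : IsClosed W) (υ₂ : G' ⟶ G) (K' E' : Set G') (Es' Ns' : List (Set G')),
    (Tower.InvB₄ O k θ P q Y Ch (fun _ _ _ _ _ _ _ _ _ σ _ 𝓔 => Flat (𝓔.subschemeι ≫ σ ≫ q)) F₉ Z₉ hZ₉ F₁₀ υ' G γ T E Es Ns K ∧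
      IsClosed K ∧ K ⊆ closure (K \ E) ∧ K ≠ Set.univ) →
    ((H = E ∧ KH = K) ∨ (H ∈ Es ∧ KH = ∅)) → W ∈ E :: Es → ConeWitness G H hH W Z hZ →
    Z ⊆ T → Z.Nonempty →
    (∀ x : redSub G Z hZ, IsRegularLocalRing ((redSub G Z hZ).presheaf.stalk x)) →
    (∀ z : ↥(redSub G Z hZ), IsClosed ({z} : Set ↥(redSub G Z hZ)) → ringKrullDim ((redSub G Z hZ).presheaf.stalk z) = ((1 : ℕ) : WithBot ℕ∞)) →
    IsBlowup υ₂ (vanishingIdeal (⟨Z, hZ⟩ : Closeds G)) →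
    (K' = ∅ ∨ (closure (Z \ closure KH) = Z ∧ K' = closure (υ₂ ⁻¹' (KH \ Z)))) →
    (E' = υ₂ ⁻¹' Z ∨ E' = closure (υ₂ ⁻¹' (H \ Z))) →
    (∀ F' ∈ Es', ∃ F ∈ E :: Es,
      (F = H ∨ F = W ∨ Disjoint Z F ∨
        ∃ hF : IsClosed F,
          (∀ g ∈ Z ∩ F, stalkIdeal (vanishingIdeal (⟨Z, hZ⟩ : Closeds G)) g ⊔ stalkIdeal (vanishingIdeal (⟨F, hF⟩ : Closeds G)) g =
              maximalIdeal (G.presheaf.stalk g)) ∧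
            ∀ g ∈ Z ∩ F, stalkIdeal (vanishingIdeal (⟨Z, hZ⟩ : Closeds G)) g ≠ maximalIdeal (G.presheaf.stalk g)) ∧
      F' = closure (υ₂ ⁻¹' (F \ Z))) →
    (∀ F' ∈ Ns', ∃ F : Set G, (F ∈ Ns ∨ F ∈ E :: Es) ∧ F' = closure (υ₂ ⁻¹' (F \ Z))) →
    (Tower.InvB₄ O k θ P q Y Ch (fun _ _ _ _ _ _ _ _ _ σ _ 𝓔 => Flat (𝓔.subschemeι ≫ σ ≫ q)) F₉ Z₉ hZ₉ F₁₀ υ' G' (υ₂ ≫ γ) (closure (υ₂ ⁻¹' (T \ Z))) E' Es' Ns' K' ∧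
      IsClosed K' ∧ K' ⊆ closure (K' \ E') ∧ K' ≠ Set.univ) := by
  intro F₉ Z₉ hZ₉ F₁₀ υ' G G' γ T E Es Ns K H KH hH Z hZ W hW υ₂ K' E' Es' Ns' hI hhost hWmem hpair hZT hZne hZreg hZdim hυ₂ hK' hE' hEs' hNs'
  obtain ⟨hinv, hKcl, hKE, hKne⟩ := hI
  obtain ⟨hυ', hZinf, hGint, hTcl, hTirr, hEcl, hTE, hEsB, hNsB, X, σ, S, jG, tG, hCh, hXint, hXnoeth, hXreg, hdom, hsq, hTS, hExc, hExcF⟩ := hinv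
  haveI := hGint
  haveI := hXint
  haveI := hXnoeth
  have hZH : Z ⊆ H := fun z hz => by
    have h := hpair.1 ▸ hz
    exact h.1
  have hZsupp : ((vanishingIdeal (⟨Z, hZ⟩ : Closeds G) : G.IdealSheafData).support : Set G) = Z :=
    Scheme.IdealSheafData.coe_support_vanishingIdeal _
  -- the candidates `E :: Es`, shadows forgotten
  have hCand : ∀ F ∈ E :: Es, ∃ hF : IsClosed F, ¬ T ⊆ F ∧
      Tower.Exc₄ O P q Y (fun _ _ _ _ _ _ _ _ _ σ _ 𝓔 => Flat (𝓔.subschemeι ≫ σ ≫ q)) Z₉ hZ₉ υ' G γ F hF ∅ X σ jG := by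
    intro F hF
    rcases List.mem_cons.mp hF with rfl | hF
    · exact ⟨hEcl, hTE, Tower.exc₄_forgetShadow O P q Y _ (hExc hEcl)⟩
    · exact ⟨(hEsB F hF).1, (hEsB F hF).2, hExcF F hF (hEsB F hF).1⟩
  -- the host's datum and bookkeeping
  have hhost' : ¬ T ⊆ H ∧ Tower.Exc₄ O P q Y (fun _ _ _ _ _ _ _ _ _ σ _ 𝓔 => Flat (𝓔.subschemeι ≫ σ ≫ q)) Z₉ hZ₉ υ' G γ H hH KH X σ jG ∧
      IsClosed KH ∧ KH ⊆ closure (KH \ H) ∧ KH ≠ Set.univ := by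
    rcases hhost with ⟨rfl, rfl⟩ | ⟨hmem, rfl⟩
    · exact ⟨hTE, hExc hH, hKcl, hKE, hKne⟩
    · refine ⟨(hEsB H hmem).2, hExcF H hmem hH, isClosed_empty, Set.empty_subset _, ?_⟩
      obtain ⟨z, _⟩ := hZne
      haveI : Nonempty G := ⟨z⟩
      exact Set.empty_ne_univ
  obtain ⟨hTH, hExcH, hKHcl, hKHE, hKHne⟩ := hhost'
  have hTZ : ¬ T ⊆ Z := fun h => hTH (h.trans hZH)
  -- the dischargers at `FE`
  have hP := Tower.hPair_of_coneWitness O k θ hθ P q Y hYirr hYcl hPnoeth hPreg Ch hChSplit hA1 hA2 Z₉ hZ₉ υ' G γ T H hH Z hZ W hW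
    hTH hpair hZreg hZdim X σ S jG tG hCh hXint hXnoeth hXreg hdom hsq hTS
  have hS := Tower.hShadow_of_any O k θ hθ P q ‹IsProper q› Y hYirr hYcl hPnoeth hPreg Ch hChSplit ‹IsIntegral P› Z₉ hZ₉ υ' G G' γ T H KH hH Z hZ
    υ₂ hυ₂
  have hSo := Tower.hShadowOld_of_any O k θ hθ P q ‹IsProper q› Y hYirr hYcl hPnoeth hPreg Ch hChSplit ‹IsIntegral P› Z₉ hZ₉ υ' G G' γ T H KH hH
    Z hZ υ₂ hυ₂
  have hBorn : ∀ (X : Scheme.{0}) (σ : X ⟶ P) (S : Set X) (jG : G ⟶ X) (tG : G ⟶ Spec (.of k)) (𝓔 𝒦₁ : X.IdealSheafData)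
      (X'' : Scheme.{0}) (τ : X'' ⟶ X) (j₂ : G' ⟶ X'') (t₂ : G' ⟶ Spec (.of k)),
      Ch X σ S → IsIntegral X → IsLocallyNoetherian X → Scheme.IsRegular X → IsDominant (σ ≫ q) →
      IsPullback jG tG (σ ≫ q) (Spec.map (CommRingCat.ofHom θ)) → jG '' T = S →
      (𝓔 ⊔ 𝒦₁).comap jG = vanishingIdeal ⟨Z, hZ⟩ → Flat ((𝓔 ⊔ 𝒦₁).subschemeι ≫ σ ≫ q) → Scheme.IsRegular (𝓔 ⊔ 𝒦₁).subscheme →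
      Scheme.IsRegular 𝓔.subscheme → IsBlowup τ (𝓔 ⊔ 𝒦₁) → IsPullback j₂ t₂ ((τ ≫ σ) ≫ q) (Spec.map (CommRingCat.ofHom θ)) →
      j₂ ≫ τ = υ₂ ≫ jG →
      Flat ((((𝓔 ⊔ 𝒦₁).comap τ)).subschemeι ≫ (τ ≫ σ) ≫ q) := by
    intro X σ S jG tG 𝓔 𝒦₁ X'' τ j₂ t₂ _ _ hXnoeth hXreg _ _ _ _ hc2 hc3 _ hτ _ _
    haveI := hXnoeth
    rw [Category.assoc]
    exact flat_exceptional_of_isBlowup_regularCentre O X X'' (σ ≫ q) (𝓔 ⊔ 𝒦₁) hXreg hc3 hc2 τ hτ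
  have hIso : ∀ (G₀ G₀' : Scheme.{0}) (γ₀ : G₀ ⟶ F₁₀) (γ₀' : G₀' ⟶ F₁₀) (E₀ : Set G₀) (E₀' : Set G₀') (X₀ X₀'' : Scheme.{0})
      (σ₀ : X₀ ⟶ P) (j₀ : G₀ ⟶ X₀) (j₀' : G₀' ⟶ X₀'') (𝓔₀ : X₀.IdealSheafData) (𝓔₀' : X₀''.IdealSheafData) (τ₀ : X₀'' ⟶ X₀),
      (∃ e : 𝓔₀'.subscheme ≅ 𝓔₀.subscheme, e.hom ≫ 𝓔₀.subschemeι = 𝓔₀'.subschemeι ≫ τ₀) →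
      (fun _ _ _ _ _ _ _ _ _ σ _ 𝓔 => Flat (𝓔.subschemeι ≫ σ ≫ q)) F₉ Z₉ hZ₉ F₁₀ υ' G₀ γ₀ E₀ X₀ σ₀ j₀ 𝓔₀ →
      (fun _ _ _ _ _ _ _ _ _ σ _ 𝓔 => Flat (𝓔.subschemeι ≫ σ ≫ q)) F₉ Z₉ hZ₉ F₁₀ υ' G₀' γ₀' E₀' X₀'' (τ₀ ≫ σ₀) j₀' 𝓔₀' := by
    intro G₀ G₀' γ₀ γ₀' E₀ E₀' X₀ X₀'' σ₀ j₀ j₀' 𝓔₀ 𝓔₀' τ₀ he hflat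
    obtain ⟨e, he⟩ := he
    have hflat' : Flat (𝓔₀.subschemeι ≫ σ₀ ≫ q) := hflat
    have heq : 𝓔₀'.subschemeι ≫ (τ₀ ≫ σ₀) ≫ q = e.hom ≫ 𝓔₀.subschemeι ≫ σ₀ ≫ q := by
      rw [← Category.assoc e.hom, he]; simp only [Category.assoc]
    show Flat (𝓔₀'.subschemeι ≫ (τ₀ ≫ σ₀) ≫ q)
    rw [heq]
    infer_instance
  -- T23-A′: the strict-transform transport of the datum `FE` (res-L1-w45b-stub-2's T-STFLAT-GEN)
  have hRuledSt : ∀ (G₀ G₀' : Scheme.{0}) (γ₀ : G₀ ⟶ F₁₀) (γ₀' : G₀' ⟶ F₁₀) (E₀ : Set G₀) (E₀' : Set G₀') (X₀ X₀'' : Scheme.{0})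
      (σ₀ : X₀ ⟶ P) (j₀ : G₀ ⟶ X₀) (j₀' : G₀' ⟶ X₀'') (𝓔₀ C₀ : X₀.IdealSheafData) (τ₀ : X₀'' ⟶ X₀),
      IsBlowup τ₀ C₀ → IsLocallyNoetherian X₀ → IsLocallyNoetherian X₀'' →
      (fun _ _ _ _ _ _ _ _ _ σ _ 𝓔 => Flat (𝓔.subschemeι ≫ σ ≫ q)) F₉ Z₉ hZ₉ F₁₀ υ' G₀ γ₀ E₀ X₀ σ₀ j₀ 𝓔₀ →
      (fun _ _ _ _ _ _ _ _ _ σ _ 𝓔 => Flat (𝓔.subschemeι ≫ σ ≫ q)) F₉ Z₉ hZ₉ F₁₀ υ' G₀' γ₀' E₀' X₀'' (τ₀ ≫ σ₀) j₀'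
        (strictTransformIdeal τ₀ C₀ 𝓔₀) := by
    intro G₀ G₀' γ₀ γ₀' E₀ E₀' X₀ X₀'' σ₀ j₀ j₀' 𝓔₀ C₀ τ₀ hτ₀ hX₀ hX₀'' hflat
    haveI := hX₀
    haveI := hX₀''
    have hflat' : Flat (𝓔₀.subschemeι ≫ σ₀ ≫ q) := hflat
    show Flat ((strictTransformIdeal τ₀ C₀ 𝓔₀).subschemeι ≫ (τ₀ ≫ σ₀) ≫ q)
    exact flat_strictTransform_subschemeι_comp_stage O σ₀ q τ₀ C₀ hτ₀ 𝓔₀ hflat'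
  -- T23-A′: the third transport alternative = the stalkwise (T1) ∧ (T2) of `RoundTransportOKPrime`
  let X3 : Set G → Prop := fun F => ∃ hF : IsClosed F,
    (∀ g ∈ Z ∩ F, stalkIdeal (vanishingIdeal (⟨Z, hZ⟩ : Closeds G)) g ⊔ stalkIdeal (vanishingIdeal (⟨F, hF⟩ : Closeds G)) g =
        maximalIdeal (G.presheaf.stalk g)) ∧
      ∀ g ∈ Z ∩ F, stalkIdeal (vanishingIdeal (⟨Z, hZ⟩ : Closeds G)) g ≠ maximalIdeal (G.presheaf.stalk g)
  have hEs'' : ∀ F' ∈ Es', ∃ F ∈ E :: Es, (F = H ∨ F = W ∨ Disjoint Z F ∨ X3 F) ∧ F' = closure (υ₂ ⁻¹' (F \ Z)) := by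
    intro F' hF'
    obtain ⟨F, hF, hok⟩ := hEs' F' hF'
    exact ⟨F, hF, hok⟩
  -- T23-A′ (A′-1): snc of a transversally crossed member with the centre (res-L1-w45b-lead-2 p608670)
  have hSNC : ∀ (C 𝓕 : X.IdealSheafData) (F : Set G) (hF : IsClosed F), X3 F → IsProper (σ ≫ q) →
      C.comap jG = vanishingIdeal ⟨Z, hZ⟩ → Flat (C.subschemeι ≫ σ ≫ q) → Scheme.IsRegular C.subscheme →
      𝓕.comap jG = vanishingIdeal ⟨F, hF⟩ → (∀ z : X, (stalkIdeal 𝓕 z).IsPrincipal) → Scheme.IsRegular 𝓕.subscheme →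
      σ '' (𝓕.support : Set X) ⊆ {p : P | ¬ IsGenericPoint p Y} →
      (fun _ _ _ _ _ _ _ _ _ σ _ 𝓔 => Flat (𝓔.subschemeι ≫ σ ≫ q)) F₉ Z₉ hZ₉ F₁₀ υ' G γ F X σ jG 𝓕 → ¬ T ⊆ F →
      HasSNCWith [𝓕] C := by
    intro C 𝓕 F hF hX3 hprop hC _ hCreg hF1 hF2 hF3 _ _ hTF
    obtain ⟨hF', hT1, hT2⟩ := hX3
    haveI := hprop
    have h𝓕0 : 𝓕 ≠ ⊥ := by
      rintro rfl
      apply hTF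
      have h1 : (vanishingIdeal (⟨F, hF⟩ : Closeds G) : G.IdealSheafData) = ⊥ := by
        rw [← hF1, Scheme.IdealSheafData.comap_bot]
      have h2 : ((vanishingIdeal (⟨F, hF⟩ : Closeds G) : G.IdealSheafData).support : Set G) = Set.univ := by
        rw [h1, Scheme.IdealSheafData.support_bot]; rfl
      rw [Scheme.IdealSheafData.coe_support_vanishingIdeal] at h2
      change F = Set.univ at h2
      rw [h2]; exact Set.subset_univ _
    exact hasSNCWith_member_centre_of_trace_transversal hXreg hsq hθ hC hCreg hF1 hF2 hF3 h𝓕0 hT1 hT2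
  -- T23-A′ (A′-3): the special-fibre trace of the strict transform (res-L1-w45b-stub-2, slim twin)
  have hTrace : ∀ (C 𝓕 : X.IdealSheafData) (F : Set G) (hF : IsClosed F) (X₂ : Scheme.{0}) (τ : X₂ ⟶ X) (j₂ : G' ⟶ X₂)
      (t₂ : G' ⟶ Spec (.of k)), X3 F → IsProper (σ ≫ q) →
      C.comap jG = vanishingIdeal ⟨Z, hZ⟩ → Flat (C.subschemeι ≫ σ ≫ q) → Scheme.IsRegular C.subscheme →
      IsBlowup τ C → IsLocallyNoetherian X₂ → IsPullback j₂ t₂ ((τ ≫ σ) ≫ q) (Spec.map (CommRingCat.ofHom θ)) → j₂ ≫ τ = υ₂ ≫ jG →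
      𝓕.comap jG = vanishingIdeal ⟨F, hF⟩ → (∀ z : X, (stalkIdeal 𝓕 z).IsPrincipal) → Scheme.IsRegular 𝓕.subscheme →
      σ '' (𝓕.support : Set X) ⊆ {p : P | ¬ IsGenericPoint p Y} →
      (fun _ _ _ _ _ _ _ _ _ σ _ 𝓔 => Flat (𝓔.subschemeι ≫ σ ≫ q)) F₉ Z₉ hZ₉ F₁₀ υ' G γ F X σ jG 𝓕 → ¬ T ⊆ F →
      HasSNCWith [𝓕] C →
      (strictTransformIdeal τ C 𝓕).comap j₂ = vanishingIdeal (⟨closure (υ₂ ⁻¹' (F \ Z)), isClosed_closure⟩ : Closeds G') := by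
    intro C 𝓕 F hF X₂ τ j₂ t₂ hX3 _ hC hCflat _ hτ hX₂ hsq₂ hcomm hF1 _ _ _ _ _ hE
    obtain ⟨hF', hT1, hT2⟩ := hX3
    haveI := hX₂
    exact comap_strictTransformIdeal_eq_vanishingIdeal_of_transversal' hsq hθ hτ hυ₂ hcomm hsq₂ hC hCflat hT1 hT2 hF1 hE
  -- the core
  have hNs'' : ∀ F' ∈ Ns', ∃ F : Set G, (F ∈ Ns ∨ F ∈ H :: (E :: Es)) ∧ F' = closure (υ₂ ⁻¹' (F \ Z)) := by
    intro F' hF'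
    obtain ⟨F, hF, rfl⟩ := hNs' F' hF'
    exact ⟨F, hF.imp id (fun h => List.mem_cons_of_mem _ h), rfl⟩
  have hB := Tower.invB₄_pairRoundCore O k θ hθ P q Y hYirr hYcl hPnoeth hPreg Ch hChSplit hChStep _ Z₉ hZ₉ υ' hIso hRuledSt G G' γ T H KH
    (E :: Es) hH Z hZ υ₂ hυ' hZinf hTirr hTH X σ S jG tG hCh hXreg hdom hsq hTS hExcH hCand Ns hNsB W hW hWmem hpair hZT hυ₂ hKHcl hKHE hKHne
    (hP · ·) hS hSo hBorn X3 hSNC hTrace K' E' Es' Ns' hK' hE' hEs'' hNs''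
  have hG'int : IsIntegral G' := hB.2.2.1
  haveI := hG'int
  -- the side facts of `K'`
  rcases hK' with rfl | ⟨-, rfl⟩
  · exact ⟨hB, isClosed_empty, Set.empty_subset _, Set.empty_ne_univ⟩
  · have hne : closure (υ₂ ⁻¹' (KH \ Z)) ≠ Set.univ :=
      closure_preimage_ne_univ υ₂ _ hυ₂ KH Z hKHcl hKHne hZ (fun h => hTZ (h ▸ Set.subset_univ _)) hZsupp.le _
        (Set.preimage_mono fun z hz => hz.1)
    refine ⟨hB, isClosed_closure, ?_, hne⟩
    rcases hE' with rfl | rfl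
    · exact closure_preimage_diff_subset_closure_diff_preimage υ₂ KH Z
    · have h := closure_preimage_diff_subset_of_isBlowup υ₂ (vanishingIdeal (⟨Z, hZ⟩ : Closeds G)) hυ₂ KH H hH hKHE
      rw [hZsupp] at h
      exact h


end Fact

end Summit.ResolutionOfSingularities.ResolutionOfSingularities.Cruxes.EquisingularLiftNat.Sections

end
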